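import Literature.MathematicalPhysics.QuantumLattice.LiebWuRootDensityIdentification
import HarnessLib

/-!
# Lieb–Wu's closed forms (18)–(19) solve their integral equations at `Q = π`, `B = ∞`

Family `hubbard`. Lieb–Wu, PRL 20 (1968) 1445, derive from the coupled integral equations
(13)–(14) for the densities `ρ(k)` (momenta, on `[-Q, Q]`) and `σ(Λ)` (rapidities, on `[-B, B]`),
"for `B = ∞` and `Q = π`", "in closed form by Fourier transforms" (reprint p. 67, L23), the
densities of the half-filled absolute ground state
* (18) `σ₀(Λ) = (2π)⁻¹ ∫₀^∞ sech(¼ωU) cos(ωΛ) J₀(ω) dω`,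
* (19) `ρ₀(k) = (2π)⁻¹ + π⁻¹ cos k ∫₀^∞ cos(ω sin k) J₀(ω) dω/(1 + exp(½ωU))`,
and from (17) the energy (20). The tree had `ρ₀` (`liebWuRho0`, with `∫_{-π}^{π} ρ₀ = 1` and
`-2∫_{-π}^{π} ρ₀ cos = liebWuEnergy`) but not `σ₀`. This file defines `σ₀` AS PRINTED
(`liebWuSigma0`) and PROVES that the pair `(ρ₀, σ₀)` satisfies the `Q = π`, `B = ∞` equations
in the kernel form of Lieb–Wu, Physica A 321 (2003) 1, §4/§6 (`K = K_{U/4}`, `K² = K_{U/2}` the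
Cauchy kernels `Literature.Analysis.SpecialFunctions.cauchyDensity`):
* `liebWuRho0_eq_integral_sigma0`: `ρ₀(k) = 1/2π + cos k ∫_ℝ K_{U/4}(sin k - Λ) σ₀(Λ) dΛ` (eq. (13));
* `liebWuSigma0_eq_integral_rho0_sub`:
  `σ₀(Λ) = ∫_{-π}^{π} K_{U/4}(Λ - sin k) ρ₀(k) dk - ∫_ℝ K_{U/2}(Λ - Λ') σ₀(Λ') dΛ'` (eq. (14));
* `integral_liebWuSigma0`: `∫_ℝ σ₀ = 1/2` (eq. (16) with `M/N_a = ½`: statement (b), `S_z = 0`);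
together with `Continuous (liebWuRho0 U)`, `Integrable (liebWuSigma0 U)`, `0 < σ₀`. With `∫_{-π}^{π} ρ₀ = 1`
(eq. (15), `N = N_a`) and (17) = (20) (`LiebWuThermodynamicLimit`) this is the complete printed sentence
"(18)–(20) is the `B = ∞`, `Q = π` solution of (13)–(17)"; the packaging as an instance of
`IsLiebWuDensities U π univ` (file `LiebWuIntegralEquations`) is kept out so that the two files are independent.

## Proof (Fourier transforms, as printed)

`∫₀^∞ cos(ωy)/cosh(cω) dω = π r_c(y)` (`sechKernel`, `SechCosineTransform`), Bessel's integral and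
Fubini give `σ₀(Λ) = (2π)⁻¹ ∫_{-π/2}^{π/2} r_{U/4}(Λ - sin θ) dθ` (`liebWuSigma0_eq_integral_sechKernel`),
the analogue of `ρ₀(k) = 1/2π + (cos k/π) ∫_{-π/2}^{π/2} u_{U/4}(sin k - sin θ) dθ`
(`integral_fermiKernel_sub_sin`). Eq. (13) is then the kernel identity `K ∗ r = 2u`
(`integral_sechKernel_mul_cauchyDensity`); eq. (14) is the NEW kernel identity `K² ∗ r = 2K - r`
(`integral_sechKernel_mul_cauchyDensity_two_mul`; Fourier side `sech A·e^{-2A} + sech A = 2e^{-A}`),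
the vanishing of `∫_{-π}^{π} cos k · g(sin k) dk` and the fold `∫_{-π}^{π} g(sin k) = 2∫_{-π/2}^{π/2} g(sin θ)`.

## References

* E. H. Lieb, F. Y. Wu, Phys. Rev. Lett. 20 (1968) 1445, eqs. (13)–(20) (key `LiebWuPRL1968`;
  reprint A. Montorsi (ed.), The Hubbard Model, World Scientific, p. 67, L1–37).
* E. H. Lieb, F. Y. Wu, Physica A 321 (2003) 1 = arXiv:cond-mat/0207529, §4 (kernels `K`, `K²`),
  §5 (operators `R̂`, `Û`, eq. (U)), §6 (boxed `ρ₀`, `σ₀`) (key `LiebWuPhysicaA2003`).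
-/

noncomputable section

open MeasureTheory Set Real Filter intervalIntegral
open Literature.Analysis.SpecialFunctions Literature.Analysis.FunctionSpaces
open scoped Topology FourierTransform Convolution

namespace Literature.MathematicalPhysics.QuantumLattice

/-! ### `σ₀` as printed (eq. (18)) -/

/-- The integrand `sech(¼ωU) cos(ωΛ) J₀(ω)` of eq. (18). [cite: LiebWuPRL1968, eq. (18)] -/
def liebWuSigma0Integrand (U Λ ω : ℝ) : ℝ :=
  Real.cos (ω * Λ) * besselJ 0 ω / Real.cosh (ω * U / 4)

/-- **Lieb–Wu's rapidity density of the half-filled Hubbard chain** (`B = ∞`, `Q = π`), eq. (18):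
`σ₀(Λ) = (2π)⁻¹ ∫₀^∞ sech(¼ωU) cos(ωΛ) J₀(ω) dω`; Physica A 321 (2003) 1, §6, boxed `σ₀(Λ)`.
[cite: LiebWuPRL1968, eq. (18)] -/
def liebWuSigma0 (U Λ : ℝ) : ℝ :=
  1 / (2 * π) * ∫ ω in Ioi (0 : ℝ), liebWuSigma0Integrand U Λ ω

/-- `liebWuSigma0` unfolded to eq. (18). [cite: LiebWuPRL1968, eq. (18)] -/
theorem liebWuSigma0_eq (U Λ : ℝ) :
    liebWuSigma0 U Λ = 1 / (2 * π) *
      ∫ ω in Ioi (0 : ℝ), Real.cos (ω * Λ) * besselJ 0 ω / Real.cosh (ω * U / 4) :=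
  rfl

/-! ### The kernel identity `K² ∗ r = 2K - r` -/

/-- The multiplier identity behind `K̂²R̂ = 2K̂ - R̂`: `sech A · e^{-2A} + sech A = 2e^{-A}`.
[cite: LiebWuPhysicaA2003, §5, eq. (U)] -/
theorem sech_mul_exp_neg_two_mul_add_sech (A : ℝ) :
    1 / Real.cosh A * Real.exp (-(2 * A)) + 1 / Real.cosh A = 2 * Real.exp (-A) := by
  rw [Real.cosh_eq, show Real.exp (-(2 * A)) = Real.exp (-A) * Real.exp (-A) by
    rw [← Real.exp_add]; ring_nf]
  have hE := Real.exp_pos A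
  have hE' := Real.exp_pos (-A)
  have hprod : Real.exp A * Real.exp (-A) = 1 := by rw [← Real.exp_add]; simp
  field_simp
  nlinarith [hprod]

/-- **`K_{2c} ∗ r_c = 2K_c - r_c`** (the kernel form of `K̂²R̂ = 2K̂ - R̂`, from `R̂ = 2K̂(1 + K̂²)⁻¹`):
`∫ r_c(t) K_{2c}(z - t) dt = 2K_c(z) - r_c(z)` for `c > 0` and all `z`. Proof: both sides are
continuous integrable with Fourier transforms `sech(A)e^{-2A}` and `2e^{-A} - sech A`, `A = 2πc|ξ|`.
[cite: LiebWuPhysicaA2003, §5, eq. (U)] -/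
theorem integral_sechKernel_mul_cauchyDensity_two_mul {c : ℝ} (hc : 0 < c) (z : ℝ) :
    ∫ t, sechKernel c t * cauchyDensity (2 * c) (z - t) = 2 * cauchyDensity c z - sechKernel c z := by
  have h2c : 0 < 2 * c := by positivity
  set KC : ℝ → ℂ := fun t => (cauchyDensity c t : ℂ) with hKC
  set K2C : ℝ → ℂ := fun t => (cauchyDensity (2 * c) t : ℂ) with hK2C
  set rC : ℝ → ℂ := fun t => (sechKernel c t : ℂ) with hrC
  have hKi : Integrable KC := (integrable_cauchyDensity hc.le).ofReal
  have hK2i : Integrable K2C := (integrable_cauchyDensity h2c.le).ofReal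
  have hri : Integrable rC := (integrable_sechKernel hc).ofReal
  have hKc : Continuous KC := Complex.continuous_ofReal.comp (continuous_cauchyDensity hc)
  have hK2c : Continuous K2C := Complex.continuous_ofReal.comp (continuous_cauchyDensity h2c)
  have hrc : Continuous rC := Complex.continuous_ofReal.comp (continuous_sechKernel hc)
  have hK2B : ∀ x, ‖K2C x‖ ≤ 1 / (π * (2 * c)) := fun x => by
    simp only [hK2C, Complex.norm_real, Real.norm_eq_abs, abs_of_pos (cauchyDensity_pos h2c x)]
    exact cauchyDensity_le h2c x
  obtain ⟨hconv_c, hconv_i⟩ := continuous_integrable_convolution hri hK2i hK2c hK2B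
  -- `F := r ∗ K₂ + r`, `G := 2K`
  have hFG : ((rC ⋆[ContinuousLinearMap.mul ℂ ℂ] K2C) + rC) = fun x => (2 : ℂ) * KC x := by
    refine eq_of_fourier_eq_of_continuous (hconv_c.add hrc) (continuous_const.mul hKc)
      (hconv_i.add hri) (hKi.const_mul _) ?_
    ext ξ
    rw [fourier_add_apply hconv_i hri, fourier_const_mul_apply,
      Real.fourier_mul_convolution_eq hri hK2i, hKC, hK2C, hrC,
      fourier_cauchyDensity hc, fourier_cauchyDensity h2c, fourier_sechKernel hc]
    have h := sech_mul_exp_neg_two_mul_add_sech (2 * π * c * |ξ|)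
    have hcosh : Real.cosh (2 * π * c * ξ) = Real.cosh (2 * π * c * |ξ|) := by
      rw [← Real.cosh_abs (2 * π * c * ξ), abs_mul, abs_of_pos (by positivity : 0 < 2 * π * c)]
    rw [hcosh, show 2 * π * (2 * c) * |ξ| = 2 * (2 * π * c * |ξ|) by ring]
    exact_mod_cast h
  have hx := congrFun hFG z
  simp only [Pi.add_apply] at hx
  rw [hrC, hK2C, hKC, convolution_ofReal_apply] at hx
  beta_reduce at hx
  have hx' : (∫ t, sechKernel c t * cauchyDensity (2 * c) (z - t)) + sechKernel c z =
      2 * cauchyDensity c z := by exact_mod_cast hx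
  linarith

/-! ### The sech kernel averaged over `sin θ` is `2πσ₀` -/

/-- `1/cosh y ≤ 2e^{-y}`. [folklore] -/
private theorem one_div_cosh_le_two_mul_exp_neg (y : ℝ) : 1 / Real.cosh y ≤ 2 * Real.exp (-y) := by
  rw [Real.cosh_eq, div_le_iff₀ (by positivity)]
  have hE := Real.exp_pos y
  have hE' := Real.exp_pos (-y)
  have hprod : Real.exp (-y) * Real.exp y = 1 := by rw [← Real.exp_add]; simp
  nlinarith [hprod]

/-- The sech kernel is a half-line cosine transform: `r_c(y) = π⁻¹ ∫₀^∞ cos(ωy)/cosh(cω) dω` (`c > 0`)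
(Lieb–Wu: `R̂` "has a Fourier transform `½ sech(ωU/4)`. The inverse Fourier transform is proportional
to `sech(2πx/U)`"). [cite: LiebWuPhysicaA2003, §5, proof of Theorem 1, kernel of R̂] -/
theorem sechKernel_eq_integral_cos_div_cosh {c : ℝ} (hc : 0 < c) (y : ℝ) :
    sechKernel c y = π⁻¹ * ∫ ω in Ioi (0 : ℝ), Real.cos (ω * y) / Real.cosh (c * ω) := by
  have h := integral_cos_div_cosh hc y
  have hfun : (fun ω => Real.cos (ω * y) / Real.cosh (c * ω)) =
      fun ω => Real.cos (y * ω) / Real.cosh (c * ω) := by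
    funext ω; rw [mul_comm ω y]
  rw [hfun, h, sechKernel]
  have hcosh := Real.cosh_pos (π * y / (2 * c))
  field_simp

/-- **`∫_{-π/2}^{π/2} r_c(x - sin θ) dθ = ∫₀^∞ cos(ωx) J₀(ω)/cosh(cω) dω`** (Fubini and Bessel's
integral): the sech kernel averaged over the momenta of a uniformly filled band is the
`ω`-integral of eq. (18). [cite: LiebWuPRL1968, eq. (18)] -/
theorem integral_sechKernel_sub_sin {c : ℝ} (hc : 0 < c) (x : ℝ) :
    ∫ θ in (-(π / 2))..(π / 2), sechKernel c (x - Real.sin θ) =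
      ∫ ω in Ioi (0 : ℝ), Real.cos (ω * x) * besselJ 0 ω / Real.cosh (c * ω) := by
  -- the joint integrand and its domination by `2e^{-cω}`
  set I : ℝ → ℝ → ℝ := fun θ ω => Real.cos (ω * (x - Real.sin θ)) / Real.cosh (c * ω) with hI
  have hIcont : Continuous (Function.uncurry I) := by
    simp only [hI, Function.uncurry_def]
    exact (by fun_prop : Continuous fun p : ℝ × ℝ => Real.cos (p.2 * (x - Real.sin p.1))).div
      (Real.continuous_cosh.comp (by fun_prop)) fun p => (Real.cosh_pos _).ne'
  haveI : IsFiniteMeasure (volume.restrict (Set.uIoc (-(π / 2)) (π / 2))) := by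
    refine isFiniteMeasure_restrict.2 ?_
    simp [Set.uIoc, Real.volume_Ioc]
  have hg : Integrable (fun z : ℝ × ℝ => (1 : ℝ) * (2 * Real.exp (-c * z.2)))
      ((volume.restrict (Set.uIoc (-(π / 2)) (π / 2))).prod (volume.restrict (Ioi (0 : ℝ)))) :=
    Integrable.mul_prod (integrable_const 1) ((exp_neg_integrableOn_Ioi 0 hc).const_mul 2)
  have hF : Integrable (Function.uncurry I)
      ((volume.restrict (Set.uIoc (-(π / 2)) (π / 2))).prod (volume.restrict (Ioi (0 : ℝ)))) := by
    refine hg.mono' hIcont.aestronglyMeasurable (Filter.Eventually.of_forall fun z => ?_)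
    rw [Function.uncurry_apply_pair, Real.norm_eq_abs, one_mul, hI]
    simp only [abs_div, abs_of_pos (Real.cosh_pos _)]
    calc |Real.cos (z.2 * (x - Real.sin z.1))| / Real.cosh (c * z.2)
        ≤ 1 / Real.cosh (c * z.2) :=
          div_le_div_of_nonneg_right (Real.abs_cos_le_one _) (Real.cosh_pos _).le
      _ ≤ 2 * Real.exp (-(c * z.2)) := one_div_cosh_le_two_mul_exp_neg _
      _ = 2 * Real.exp (-c * z.2) := by rw [neg_mul]
  have hswap := MeasureTheory.intervalIntegral_integral_swap hF
  -- rewrite the left-hand side as the iterated integral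
  have hpt : ∀ θ, sechKernel c (x - Real.sin θ) = π⁻¹ * ∫ ω in Ioi (0 : ℝ), I θ ω := by
    intro θ
    rw [sechKernel_eq_integral_cos_div_cosh hc]
  simp_rw [hpt]
  rw [intervalIntegral.integral_const_mul]
  change π⁻¹ * ∫ θ in (-(π / 2))..(π / 2), ∫ ω in Ioi (0 : ℝ), Function.uncurry I (θ, ω) = _
  simp only [Function.uncurry_apply_pair] at hswap ⊢
  rw [hswap]
  -- the inner `θ`-integral at fixed `ω`
  have hinner : ∀ ω ∈ Ioi (0 : ℝ), ∫ θ in (-(π / 2))..(π / 2), I θ ω =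
      π * (Real.cos (ω * x) * besselJ 0 ω / Real.cosh (c * ω)) := by
    intro ω _
    simp only [hI]
    rw [intervalIntegral.integral_div, integral_cos_mul_sub_sin]
    ring
  rw [setIntegral_congr_fun measurableSet_Ioi hinner, MeasureTheory.integral_const_mul, ← mul_assoc,
    inv_mul_cancel₀ Real.pi_pos.ne', one_mul]

/-- **`σ₀` is the sech kernel averaged over `sin θ`:** `σ₀(Λ) = (2π)⁻¹ ∫_{-π/2}^{π/2} r_{U/4}(Λ - sin θ) dθ`
(`U > 0`). This is Lieb–Wu's `σ₀ = R̂`-image of the uniformly filled band. [cite: LiebWuPhysicaA2003, §6, boxed σ₀] -/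
theorem liebWuSigma0_eq_integral_sechKernel {U : ℝ} (hU : 0 < U) (Λ : ℝ) :
    liebWuSigma0 U Λ = 1 / (2 * π) * ∫ θ in (-(π / 2))..(π / 2), sechKernel (U / 4) (Λ - Real.sin θ) := by
  rw [liebWuSigma0, integral_sechKernel_sub_sin (by positivity : 0 < U / 4)]
  congr 1
  refine setIntegral_congr_fun measurableSet_Ioi fun ω _ => ?_
  rw [liebWuSigma0Integrand, show ω * U / 4 = U / 4 * ω by ring]


/-! ### The half period `[-π/2, π/2]` as a finite measure -/

/-- `∫_{-π/2}^{π/2} f = ∫ f d(vol|_{(-π/2, π/2]})`. [folklore] -/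
private theorem intervalIntegral_halfPeriod_eq (f : ℝ → ℝ) :
    ∫ θ in (-(π / 2))..(π / 2), f θ = ∫ θ, f θ ∂(volume.restrict (Ioc (-(π / 2)) (π / 2))) :=
  intervalIntegral.integral_of_le (by linarith [Real.pi_pos])

/-- `vol((-π/2, π/2]) = π`. [folklore] -/
private theorem restrict_halfPeriod_univ_toReal :
    ((volume.restrict (Ioc (-(π / 2)) (π / 2)) : Measure ℝ) univ).toReal = π := by
  rw [Measure.restrict_apply_univ, Real.volume_Ioc, ENNReal.toReal_ofReal (by linarith [Real.pi_pos])]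
  ring

/-- `σ₀ = (2π)⁻¹ ∫ r_{U/4}(· - sin θ) d(vol|_{(-π/2, π/2]})(θ)` as functions. [cite: LiebWuPhysicaA2003, §6, boxed σ₀] -/
theorem liebWuSigma0_eq_integral_restrict {U : ℝ} (hU : 0 < U) :
    liebWuSigma0 U = fun Λ => 1 / (2 * π) *
      ∫ θ, sechKernel (U / 4) (Λ - Real.sin θ) ∂(volume.restrict (Ioc (-(π / 2)) (π / 2))) :=
  funext fun Λ => by rw [liebWuSigma0_eq_integral_sechKernel hU, intervalIntegral_halfPeriod_eq]

/-! ### Equation (13) at `Q = π`, `B = ∞`: `K_{U/4} ∗ σ₀` is the Fermi integral of `ρ₀` -/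

/-- **`∫_ℝ K_{U/4}(x - Λ) σ₀(Λ) dΛ = π⁻¹ I(U/2, x)`** where `I = fermiCosJ0` is the `ω`-integral of
eq. (19) (`ρ₀(k) = 1/2π + (cos k/π) I(U/2, sin k)`): Fubini, the translation `Λ = t + sin θ`, the
kernel identity `K ∗ r = 2u` and `∫_{-π/2}^{π/2} u(x - sin θ) dθ = I(U/2, x)`.
[cite: LiebWuPhysicaA2003, §6, boxed ρ₀ and σ₀] -/
theorem integral_cauchyDensity_mul_liebWuSigma0 {U : ℝ} (hU : 0 < U) (x : ℝ) :
    ∫ Λ, cauchyDensity (U / 4) (x - Λ) * liebWuSigma0 U Λ = π⁻¹ * fermiCosJ0 (U / 2) x := by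
  have hc : 0 < U / 4 := by positivity
  set m : Measure ℝ := volume.restrict (Ioc (-(π / 2)) (π / 2)) with hm
  have hσ : ∀ Λ, liebWuSigma0 U Λ =
      1 / (2 * π) * ∫ θ, sechKernel (U / 4) (Λ - Real.sin θ) ∂m :=
    fun Λ => congrFun (liebWuSigma0_eq_integral_restrict hU) Λ
  have hfun : (fun Λ => cauchyDensity (U / 4) (x - Λ) * liebWuSigma0 U Λ) = fun Λ =>
      1 / (2 * π) * (cauchyDensity (U / 4) (x - Λ) * ∫ θ, sechKernel (U / 4) (Λ - Real.sin θ) ∂m) := by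
    funext Λ; rw [hσ Λ]; ring
  rw [hfun, MeasureTheory.integral_const_mul,
    integral_mul_integral_comp_sub (m := m) (continuous_sechKernel hc) (integrable_sechKernel hc)
      Real.continuous_sin (h := fun y => cauchyDensity (U / 4) (x - y))
      ((continuous_cauchyDensity hc).comp (continuous_const.sub continuous_id))
      (fun y => abs_cauchyDensity_le hc (x - y))]
  have hinner : ∀ θ, ∫ Λ, cauchyDensity (U / 4) (x - Λ) * sechKernel (U / 4) (Λ - Real.sin θ) =
      2 * fermiKernel (U / 4) (x - Real.sin θ) := by
    intro θ
    rw [integral_mul_comp_sub_translate (cauchyDensity (U / 4)) (sechKernel (U / 4)) x (Real.sin θ),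
      integral_sechKernel_mul_cauchyDensity hc]
  simp_rw [hinner]
  rw [MeasureTheory.integral_const_mul, hm, ← intervalIntegral_halfPeriod_eq,
    integral_fermiKernel_sub_sin hc, show 2 * (U / 4) = U / 2 by ring]
  field_simp

/-- **Eq. (13) at `Q = π`, `B = ∞` holds for `(ρ₀, σ₀)`:**
`ρ₀(k) = 1/2π + cos k ∫_ℝ K_{U/4}(sin k - Λ) σ₀(Λ) dΛ` (`U > 0`). [cite: LiebWuPRL1968, eqs. (13), (18), (19)] -/
theorem liebWuRho0_eq_integral_sigma0 {U : ℝ} (hU : 0 < U) (k : ℝ) :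
    liebWuRho0 U k = 1 / (2 * π) +
      Real.cos k * ∫ Λ, cauchyDensity (U / 4) (Real.sin k - Λ) * liebWuSigma0 U Λ := by
  rw [integral_cauchyDensity_mul_liebWuSigma0 hU, liebWuRho0_eq_fermiCosJ0]
  ring

/-! ### Equation (14) at `Q = π`, `B = ∞` -/

/-- **`∫_ℝ K_{U/2}(Λ - Λ') σ₀(Λ') dΛ' = π⁻¹ ∫_{-π/2}^{π/2} K_{U/4}(Λ - sin θ) dθ - σ₀(Λ)`**: Fubini,
translation, and the kernel identity `K² ∗ r = 2K - r`. [cite: LiebWuPhysicaA2003, §5, eq. (U)] -/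
theorem integral_cauchyDensity_two_mul_liebWuSigma0 {U : ℝ} (hU : 0 < U) (Λ : ℝ) :
    ∫ Λ', cauchyDensity (U / 2) (Λ - Λ') * liebWuSigma0 U Λ' =
      π⁻¹ * (∫ θ in (-(π / 2))..(π / 2), cauchyDensity (U / 4) (Λ - Real.sin θ)) - liebWuSigma0 U Λ := by
  have hc : 0 < U / 4 := by positivity
  have h2c : 0 < 2 * (U / 4) := by positivity
  have hU2 : U / 2 = 2 * (U / 4) := by ring
  set m : Measure ℝ := volume.restrict (Ioc (-(π / 2)) (π / 2)) with hm
  have hσ : ∀ Λ, liebWuSigma0 U Λ =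
      1 / (2 * π) * ∫ θ, sechKernel (U / 4) (Λ - Real.sin θ) ∂m :=
    fun Λ => congrFun (liebWuSigma0_eq_integral_restrict hU) Λ
  have hfun : (fun Λ' => cauchyDensity (U / 2) (Λ - Λ') * liebWuSigma0 U Λ') = fun Λ' =>
      1 / (2 * π) * (cauchyDensity (2 * (U / 4)) (Λ - Λ') *
        ∫ θ, sechKernel (U / 4) (Λ' - Real.sin θ) ∂m) := by
    funext Λ'; rw [hσ Λ', hU2]; ring
  rw [hfun, MeasureTheory.integral_const_mul,
    integral_mul_integral_comp_sub (m := m) (continuous_sechKernel hc) (integrable_sechKernel hc)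
      Real.continuous_sin (h := fun y => cauchyDensity (2 * (U / 4)) (Λ - y))
      ((continuous_cauchyDensity h2c).comp (continuous_const.sub continuous_id))
      (fun y => abs_cauchyDensity_le h2c (Λ - y))]
  have hinner : ∀ θ, ∫ Λ', cauchyDensity (2 * (U / 4)) (Λ - Λ') * sechKernel (U / 4) (Λ' - Real.sin θ) =
      2 * cauchyDensity (U / 4) (Λ - Real.sin θ) - sechKernel (U / 4) (Λ - Real.sin θ) := by
    intro θ
    rw [integral_mul_comp_sub_translate (cauchyDensity (2 * (U / 4))) (sechKernel (U / 4)) Λ (Real.sin θ),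
      integral_sechKernel_mul_cauchyDensity_two_mul hc]
  simp_rw [hinner]
  have hiK : Integrable (fun θ => 2 * cauchyDensity (U / 4) (Λ - Real.sin θ)) m :=
    integrable_of_continuous_of_abs_le ((continuous_const.mul
      ((continuous_cauchyDensity hc).comp (continuous_const.sub Real.continuous_sin))))
      (B := 2 * (1 / (π * (U / 4)))) fun θ => by
        rw [abs_mul, abs_of_pos (by norm_num : (0 : ℝ) < 2)]
        exact mul_le_mul_of_nonneg_left (abs_cauchyDensity_le hc _) (by norm_num)
  have hir : Integrable (fun θ => sechKernel (U / 4) (Λ - Real.sin θ)) m :=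
    integrable_of_continuous_of_abs_le
      ((continuous_sechKernel hc).comp (continuous_const.sub Real.continuous_sin))
      fun θ => abs_sechKernel_le hc _
  rw [integral_sub hiK hir, MeasureTheory.integral_const_mul, hσ Λ, hm,
    ← intervalIntegral_halfPeriod_eq, ← intervalIntegral_halfPeriod_eq]
  field_simp

/-- The Fermi average `F(s) = ∫_{-π/2}^{π/2} u_{U/4}(s - sin θ) dθ` is continuous in `s`. [folklore] -/
private theorem continuous_integral_fermiKernel_sub_sin {U : ℝ} (hU : 0 < U) :
    Continuous fun s : ℝ => ∫ θ in (-(π / 2))..(π / 2), fermiKernel (U / 4) (s - Real.sin θ) := by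
  have hc : 0 < U / 4 := by positivity
  refine intervalIntegral.continuous_parametric_intervalIntegral_of_continuous' ?_ _ _
  exact (continuous_fermiKernel hc).comp (continuous_fst.sub (Real.continuous_sin.comp continuous_snd))

/-- `ρ₀(k) = 1/2π + (cos k/π) ∫_{-π/2}^{π/2} u_{U/4}(sin k - sin θ) dθ` (the tree's
`integral_fermiKernel_sub_sin` inserted in eq. (19)). [cite: LiebWuPhysicaA2003, §6, boxed ρ₀] -/
theorem liebWuRho0_eq_integral_fermiKernel {U : ℝ} (hU : 0 < U) (k : ℝ) :
    liebWuRho0 U k = 1 / (2 * π) + Real.cos k / π *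
      ∫ θ in (-(π / 2))..(π / 2), fermiKernel (U / 4) (Real.sin k - Real.sin θ) := by
  rw [liebWuRho0_eq_fermiCosJ0, integral_fermiKernel_sub_sin (by positivity : 0 < U / 4),
    show 2 * (U / 4) = U / 2 by ring]

/-- **`ρ₀` is continuous** (`U > 0`). [cite: LiebWuPhysicaA2003, §6, boxed ρ₀] -/
theorem continuous_liebWuRho0 {U : ℝ} (hU : 0 < U) : Continuous (liebWuRho0 U) := by
  have h : liebWuRho0 U = fun k => 1 / (2 * π) + Real.cos k / π *
      ∫ θ in (-(π / 2))..(π / 2), fermiKernel (U / 4) (Real.sin k - Real.sin θ) :=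
    funext fun k => liebWuRho0_eq_integral_fermiKernel hU k
  rw [h]
  exact continuous_const.add ((Real.continuous_cos.div_const _).mul
    ((continuous_integral_fermiKernel_sub_sin hU).comp Real.continuous_sin))

/-- **`∫_{-π}^{π} K_{U/4}(Λ - sin k) ρ₀(k) dk = π⁻¹ ∫_{-π/2}^{π/2} K_{U/4}(Λ - sin θ) dθ`**: the
`cos k`-part of `ρ₀` integrates to zero against any function of `sin k`, and the constant part
folds onto the half period. [cite: LiebWuPhysicaA2003, §5, reduction to `[-π/2, π/2]`] -/
theorem integral_cauchyDensity_mul_liebWuRho0 {U : ℝ} (hU : 0 < U) (Λ : ℝ) :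
    ∫ k in (-π)..π, cauchyDensity (U / 4) (Λ - Real.sin k) * liebWuRho0 U k =
      π⁻¹ * ∫ θ in (-(π / 2))..(π / 2), cauchyDensity (U / 4) (Λ - Real.sin θ) := by
  have hc : 0 < U / 4 := by positivity
  set F : ℝ → ℝ := fun s => ∫ θ in (-(π / 2))..(π / 2), fermiKernel (U / 4) (s - Real.sin θ) with hF
  have hFc : Continuous F := continuous_integral_fermiKernel_sub_sin hU
  have hK : Continuous fun s => cauchyDensity (U / 4) (Λ - s) :=
    (continuous_cauchyDensity hc).comp (continuous_const.sub continuous_id)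
  have hpt : ∀ k, cauchyDensity (U / 4) (Λ - Real.sin k) * liebWuRho0 U k =
      1 / (2 * π) * cauchyDensity (U / 4) (Λ - Real.sin k) +
        π⁻¹ * (Real.cos k * (cauchyDensity (U / 4) (Λ - Real.sin k) * F (Real.sin k))) := by
    intro k
    rw [liebWuRho0_eq_integral_fermiKernel hU]
    ring
  simp_rw [hpt]
  have hi1 : IntervalIntegrable (fun k => 1 / (2 * π) * cauchyDensity (U / 4) (Λ - Real.sin k))
      volume (-π) π :=
    ((continuous_const.mul (hK.comp Real.continuous_sin)).intervalIntegrable _ _)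
  have hi2 : IntervalIntegrable (fun k => π⁻¹ * (Real.cos k *
      (cauchyDensity (U / 4) (Λ - Real.sin k) * F (Real.sin k)))) volume (-π) π :=
    ((continuous_const.mul (Real.continuous_cos.mul
      ((hK.mul hFc).comp Real.continuous_sin))).intervalIntegrable _ _)
  rw [intervalIntegral.integral_add hi1 hi2, intervalIntegral.integral_const_mul,
    intervalIntegral.integral_const_mul,
    integral_cos_mul_comp_sin_eq_zero (g := fun s => cauchyDensity (U / 4) (Λ - s) * F s) (hK.mul hFc),
    integral_comp_sin_neg_pi_pi (g := fun s => cauchyDensity (U / 4) (Λ - s)) hK]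
  ring

/-- **Eq. (14) at `Q = π`, `B = ∞` holds for `(ρ₀, σ₀)`:**
`σ₀(Λ) = ∫_{-π}^{π} K_{U/4}(Λ - sin k) ρ₀(k) dk - ∫_ℝ K_{U/2}(Λ - Λ') σ₀(Λ') dΛ'` (`U > 0`).
[cite: LiebWuPRL1968, eqs. (14), (18), (19)] -/
theorem liebWuSigma0_eq_integral_rho0_sub {U : ℝ} (hU : 0 < U) (Λ : ℝ) :
    liebWuSigma0 U Λ = (∫ k in (-π)..π, cauchyDensity (U / 4) (Λ - Real.sin k) * liebWuRho0 U k) -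
      ∫ Λ', cauchyDensity (U / 2) (Λ - Λ') * liebWuSigma0 U Λ' := by
  rw [integral_cauchyDensity_mul_liebWuRho0 hU, integral_cauchyDensity_two_mul_liebWuSigma0 hU]
  ring

/-! ### Positivity, integrability and the normalisation `∫σ₀ = 1/2` (eq. (16), statement (b)) -/

/-- **`σ₀ > 0`** (the kernel of `R̂` "is positive"). [cite: LiebWuPhysicaA2003, §5, Theorem 1] -/
theorem liebWuSigma0_pos {U : ℝ} (hU : 0 < U) (Λ : ℝ) : 0 < liebWuSigma0 U Λ := by
  have hc : 0 < U / 4 := by positivity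
  rw [liebWuSigma0_eq_integral_sechKernel hU]
  refine mul_pos (by positivity) (intervalIntegral.intervalIntegral_pos_of_pos
    (((continuous_sechKernel hc).comp (continuous_const.sub Real.continuous_sin)).intervalIntegrable _ _)
    (fun θ => sechKernel_pos hc _) (by linarith [Real.pi_pos]))

/-- **`σ₀ ∈ L¹(ℝ)`.** [cite: LiebWuPhysicaA2003, §5, `σ ∈ L¹`] -/
theorem integrable_liebWuSigma0 {U : ℝ} (hU : 0 < U) : Integrable (liebWuSigma0 U) := by
  rw [liebWuSigma0_eq_integral_restrict hU]
  exact (integrable_integral_comp_sub (continuous_sechKernel (by positivity : 0 < U / 4))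
    (integrable_sechKernel (by positivity)) Real.continuous_sin).const_mul _

/-- **Eq. (16) at `B = ∞`: `∫_ℝ σ₀(Λ) dΛ = 1/2 = M/N_a`** — the half-filled solution has `S_z = 0`
("this is the antiferromagnetic case, `S_z = 0`, and corresponds to the absolute ground state",
statement (b)). [cite: LiebWuPRL1968, eq. (16) and statement (b)] -/
theorem integral_liebWuSigma0 {U : ℝ} (hU : 0 < U) : ∫ Λ, liebWuSigma0 U Λ = 1 / 2 := by
  have hc : 0 < U / 4 := by positivity
  rw [liebWuSigma0_eq_integral_restrict hU, MeasureTheory.integral_const_mul,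
    integral_integral_comp_sub (continuous_sechKernel hc) (integrable_sechKernel hc) Real.continuous_sin,
    integral_sechKernel hc, restrict_halfPeriod_univ_toReal]
  field_simp

end Literature.MathematicalPhysics.QuantumLattice

end
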